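import Summits.CriticalPhenomena.PercolationContinuityZ3.Theses.PercShatteringRace
import HarnessLib

/-!
# Crux `PercShatteringRace.FreeSusceptibilityPowerSaving` = S(1/2) (stmt-CriticalPhenomena-5786), line `bk-hyperscaling-tail-transfer` — stub `stub_boundaryWebSplit` (census Dc7: `BT(1/2) ∧ FRAC ⟹ S`)

Helper file of the line lead c3 (prover-line-stmt-CriticalPhenomena-5786-c3-0), `--supports stmt-CriticalPhenomena-5786`.
It lands the registered stub `stub_boundaryWebSplit`, the crux-strategist's split Dc7 of the crux
`S(1/2)`: `∃ C, ∀ R ≥ 1, χᶠ_R := Σ_{y ∈ Λ_R} P_{p_c}(0 ↔ y in Λ_R) ≤ C R^{5/2}` (`Λ_R = box 3 R`, bond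
percolation on `ℤ³` at `p_c = criticalProbI 3`).

* `BT(1/2)` — the boundary-touching rooted volume
  `BT_R := Σ_{y ∈ Λ_R} P_{p_c}(0 ↔ y in Λ_R, 0 ↔ ∂ⁱⁿΛ_R in Λ_R) ≤ C R^{5/2}`
  (`siteToBoundary 3 R` is the in-box one-arm event `{0 ↔ ∂ⁱⁿΛ_R in Λ_R}`);
* `FRAC` — a fixed fraction `c > 0` of the free susceptibility is carried by the boundary-touching
  cluster: `c χᶠ_R ≤ BT_R`.

Glue = one division: `χᶠ_R ≤ BT_R / c ≤ (C / c) R^{5/2}`.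

Why this split is worth a name (census Dc7): behind it sits the exact spatial-Markov identity
`χᶠ_R = BT_R + E[χᶠ_U(0); 0 ∉ B]`, where `B` is the union of the boundary-touching in-box clusters and
`U` is the component of `0` in the complement of `B`, which carries fresh (conditionally independent)
percolation.  In the jump world `BT` carries the whole crux; `FRAC` is an RSW-species lower bound.
Both antecedents are open.  No definitions; Mathlib-only arithmetic
(`div_mul_eq_mul_div`, `le_div_iff₀`, `mul_comm`, `le_trans`).
-/

noncomputable section

namespace Summit.CriticalPhenomena.PercolationContinuityZ3.Theorems

open MeasureTheory Finset
open Literature.Probability.Percolation Literature.Probability.LatticeModels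

/-- **Census Dc7, `BT(1/2) ∧ FRAC ⟹ S(1/2)`.**  If the boundary-touching rooted volume satisfies
`Σ_{y ∈ Λ_R} P_{p_c}(0 ↔ y in Λ_R, 0 ↔ ∂ⁱⁿΛ_R in Λ_R) ≤ C R^{5/2}` (`BT`) and a fixed fraction `c > 0` of
the free susceptibility is carried by the boundary-touching cluster,
`c Σ_{y ∈ Λ_R} P_{p_c}(0 ↔ y in Λ_R) ≤ Σ_{y ∈ Λ_R} P_{p_c}(0 ↔ y in Λ_R, 0 ↔ ∂ⁱⁿΛ_R in Λ_R)` (`FRAC`), then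
the free susceptibility has the power saving `Σ_{y ∈ Λ_R} P_{p_c}(0 ↔ y in Λ_R) ≤ (C / c) R^{5/2}`, i.e.
the crux `FreeSusceptibilityPowerSaving`.  One division. [folklore] -/
theorem stub_boundaryWebSplit :
    (∃ C : ℝ, ∀ R : ℕ, 1 ≤ R →
        ∑ y ∈ box 3 R, (bondPercolation (zdGraph 3) (criticalProbI 3)).real
            (openConnIn ↑(box 3 R) 0 y ∩ siteToBoundary 3 R) ≤ C * (R : ℝ) ^ ((5 : ℝ) / 2)) →
      (∃ c : ℝ, 0 < c ∧ ∀ R : ℕ, 1 ≤ R →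
        c * ∑ y ∈ box 3 R, (bondPercolation (zdGraph 3) (criticalProbI 3)).real (openConnIn ↑(box 3 R) 0 y)
          ≤ ∑ y ∈ box 3 R, (bondPercolation (zdGraph 3) (criticalProbI 3)).real
              (openConnIn ↑(box 3 R) 0 y ∩ siteToBoundary 3 R)) →
      Summit.CriticalPhenomena.PercolationContinuityZ3.Theses.PercShatteringRace.FreeSusceptibilityPowerSaving := by
  rintro ⟨C, hC⟩ ⟨c, hc, hcR⟩
  refine ⟨C / c, fun R hR => ?_⟩
  -- `c χᶠ_R ≤ BT_R ≤ C R^{5/2}`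
  have h3 : c * ∑ y ∈ box 3 R, (bondPercolation (zdGraph 3) (criticalProbI 3)).real
      (openConnIn (↑(box 3 R) : Set (Site 3)) 0 y) ≤ C * (R : ℝ) ^ ((5 : ℝ) / 2) :=
    le_trans (hcR R hR) (hC R hR)
  -- divide by `c > 0`
  rw [div_mul_eq_mul_div, le_div_iff₀ hc, mul_comm]
  exact h3

end Summit.CriticalPhenomena.PercolationContinuityZ3.Theorems

end
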